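import Summits.BirchSwinnertonDyer.BirchSwinnertonDyer.Theorems.EisensteinPrimesMazurMCOnX1RankZeroInterludeResidualGL1Even
import Literature.NumberTheory.IwasawaTheory.GreenbergLemma59OfFerreroWashington
import HarnessLib

/-!
# Crux `MazurMCOnX1RankZero` (item stmt-BirchSwinnertonDyer-19035), line `interlude_with_torsion`, road B input [Even]
# from the Ferrero–Washington theorem alone (Greenberg's Lemma 5.9 is now a tree theorem modulo FW)

Cell `bsd-eis` (host `run/shared/lean/pub/bsd-eis/`), seat `bsd-eis-lam-a` g20 (staged) / g21 (filed) (PART 1b seat (4); `--supports`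
stmt-BirchSwinnertonDyer-19035 as a HELPER; no claim, closes nothing by itself).  The registered skeleton
`interlude_with_torsion` v13 closes road B's input [Even] (`greenbergEvenInput_of_stubs`) by
`EvenTransport.greenbergEvenInput_of_lemma59 stub_publishedL59`, i.e. MODULO the named fact
`Literature.NumberTheory.IwasawaTheory.greenberg1999_lemma59_even_finite` (Greenberg, LNM 1716, §5 Lemma 5.9).  That fact is
now PROVED from the Ferrero–Washington theorem (`IwasawaTheory.greenberg1999_lemma59_even_finite_of_ferreroWashington`,
`Literature/NumberTheory/IwasawaTheory/GreenbergLemma59OfFerreroWashington.lean`: Greenberg's own argument — Kummer theory and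
the reflection principle at the CM layers `ℚ(θ, μ_p)·ℚ_n`, at most `[ℚ(θ, μ_p) : ℚ]` primes above `p`, and the linear growth of
`ord_p h` given by Ferrero–Washington), and FW is already the first conjunct of the skeleton's stub `stub_publishedFW`.  This
file records the composite:

* `greenbergEvenInput_of_ferreroWashington` — the conclusion of `greenbergEvenInput_of_stubs` (skeleton v13 type, token for
  token) from `ferreroWashington1979_classicalMuVanishes` alone.

What a LEAD can do with it (said, not done): v14 of the skeleton may delete `stub_publishedL59` and set
`greenbergEvenInput_of_stubs := EvenTransport.greenbergEvenInput_of_ferreroWashington stub_publishedFW.1`.  HONEST FRAMING: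
helper theorem; Ferrero–Washington stays a named fact (`stub_publishedFW`); nothing about BSD, Mazur's main conjecture or
IMC2 is asserted; 0 cells / labels / tiers move.
[cite: Greenberg1999LNM, §5 Lemma 5.9 (pp. 142–144)] [cite: Washington1997, §7.5 Thm. 7.15]
-/

noncomputable section

set_option autoImplicit false

open scoped NumberField Pointwise
open Field IsDedekindDomain
open Literature.NumberTheory.GaloisRepresentations
open Literature.NumberTheory.EllipticCurves Literature.NumberTheory.EllipticCurves.GreenbergSelmer
open Literature.NumberTheory.EllipticCurves.GreenbergVatsal2000
open Literature.NumberTheory.IwasawaTheory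

namespace Summit.BirchSwinnertonDyer.BirchSwinnertonDyer.Theorems.InterludeWithTorsion.EvenTransport

/-- **[Even] from Ferrero–Washington.**  For `K` imaginary quadratic, `p` odd, `κ` the cyclotomic `ℤ_p`-extension of `K` and
`M` of order `p` with compatible `Γ_ℚ`/`Γ_K`-actions: there is `τ ∈ Γ_ℚ ∖ res(Γ_K)` with `(1 ± T_τ) · H¹_{unr outside p}(K_∞, M)`
finite — the conclusion of `greenbergEvenInput_of_stubs`, token for token — granted only the Ferrero–Washington theorem:
`greenbergEvenInput_of_lemma59` composed with the tree theorem `greenberg1999_lemma59_even_finite_of_ferreroWashington`.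
[cite: Greenberg1999LNM, §5 Lemma 5.9 (pp. 142–144)] [cite: Washington1997, §7.5 Thm. 7.15] -/
theorem greenbergEvenInput_of_ferreroWashington (hFW : ferreroWashington1979_classicalMuVanishes) :
    ∀ (K : Type) [Field K] [NumberField K] [IsGalois ℚ K], IsImaginaryQuadratic K →
      ∀ (p : ℕ) [Fact p.Prime], p ≠ 2 →
      ∀ (κ : ZpExtension K p) (hκ : κ.IsCyclotomic),
      ∀ (M : Type) [AddCommGroup M] [DistribMulAction (absoluteGaloisGroup ℚ) M]
        [DistribMulAction (absoluteGaloisGroup K) M] [TopologicalSpace M] [DiscreteTopology M],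
        Nat.card M = p →
        ∀ (hM : ∀ (σ : absoluteGaloisGroup K) (m : M), σ • m = (absGaloisRestrict ℚ K σ) • m),
        ∃ τ : absoluteGaloisGroup ℚ, τ ∉ Set.range (absGaloisRestrict ℚ K) ∧
          (((fun c ↦ c + cycSwapH1 κ hκ M hM τ c) ''
              (unramifiedOutside κ.kerSubgroup M p ∅ : Set (subgroupH1 κ.kerSubgroup M))).Finite ∨
            ((fun c ↦ c - cycSwapH1 κ hκ M hM τ c) ''
              (unramifiedOutside κ.kerSubgroup M p ∅ : Set (subgroupH1 κ.kerSubgroup M))).Finite) :=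
  greenbergEvenInput_of_lemma59 (greenberg1999_lemma59_even_finite_of_ferreroWashington hFW)

end Summit.BirchSwinnertonDyer.BirchSwinnertonDyer.Theorems.InterludeWithTorsion.EvenTransport

end
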